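import Mathlib
import HarnessLib

/-!
# The four-point acceptance functional and its curve inequalities (THEOREM Q♯♯ — algebraic core)

HONEST FRAMING. exact (Metropolis-corrected) sampling algorithms for lattice gauge theory; figures of
merit are autocorrelation/cost numbers at stated couplings and volumes; no continuum-physics claim.

This is the pure-algebra half of `TrivializingMaps.AcceptanceFootprintCurve` (the sharpening of the
tree's THEOREM Q `AcceptanceFootprint.abs_cov_le_of_meanAccept` to the exact acceptance/correlation
curve on `acc ∈ [½, 2/3]`).  After the randomised rounding of a witness pair `(A, B)` to `{±1}²`
(done in the companion file) everything is a statement about SIX real numbers: the target cell masses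
`x₁, x₂, x₃, x₄ ≥ 0` (`Σ = 1`) on the corners `++, +-, -+, --`, and a PRODUCT model with marginals
`(p, 1-p) ⊗ (q, 1-q)`.  The independence-sampler mean acceptance of that pair is the sixteen-term sum
`Σ_{z,w} min(x_z y_w, x_w y_z)` (the "four-point functional"; NO definition is introduced — lemmas are
stated for any `F` agreeing with the closed sixteen-term expression, hypothesis `hF`, and the export
`sum_min_curve` is `F`-free) and the connected correlation is `4 (x₁ x₄ - x₂ x₃)`.

## What is proved (all `sorry`-free, elementary real algebra)
* `fourPoint_le_diag`:  `F ≤ max(x₁, x₄) + 2 (x₂ + x₃)` — the diagonal block is bounded by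
  a square-root-free AM–GM (`two_mul_min_le`, `diag_block_le`, using `y₁ y₄ = y₂ y₃` for a product),
  the off-diagonal `min` terms by their target mass; `fourPoint_flip` gives the mirror bound.
* `fourPoint_curve_i`:  `t ≤ F ⟹ 8 |x₁ x₄ - x₂ x₃| ≤ (2 - t)²`
  (slack identity `core_i`: `(2 - T)² - 8 x₁ x₄ = ¼ (3 (x₄ - x₁) + (x₂ + x₃) - 1)² + …`).
* `fourPoint_curve_ii`: `½ ≤ t ≤ F ∧ 8/9 ≤ 4 |x₁ x₄ - x₂ x₃| ⟹ (2 t - 1)² ≤ 1 - 4 |x₁ x₄ - x₂ x₃|`,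
  i.e. `|Cov| ≤ 4 t (1 - t)` in the high-correlation regime (`core_ii`).
* the bookkeeping identity `sum_min_eq_fourPoint` (sixteen-term sum = closed expression) and the
  `F`-free export `sum_min_curve` = (i) ∧ (ii) stated directly for `Σ_{z,w ∈ {±1}²} min(x_z y_w, x_w y_z)`.

## NOT CLAIMED
The conjectured full curve `|Cov| ≤ 4 t (1 - t)` for ALL `t ∈ [½, 1]` (numerically supported, open on
`(2/3, 1]`; see the companion file's docstring); any statement about lattice gauge theory proper — this
file is finite-dimensional real algebra feeding `AcceptanceFootprintCurve`.

References: M. Lüscher, *Trivializing maps, the Wilson flow and the HMC algorithm*, CMP 293 (2010)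
[Luscher2010Trivializing] (context only); tree THEOREM Q (`AcceptanceFootprint`).
-/

namespace Summit.Ventures.LatticeQCDFlow.TrivializingMaps.Curve

/-! ## §1. Elementary inequalities -/

/-- `2 min(u, v) ≤ M (y₂ + y₃)` when `u v ≤ M² y₂ y₃` (all nonnegative): the square-root-free AM–GM step. -/
theorem two_mul_min_le {u v M y₂ y₃ : ℝ} (hu : 0 ≤ u) (hv : 0 ≤ v) (hM : 0 ≤ M) (h2 : 0 ≤ y₂)
    (h3 : 0 ≤ y₃) (huv : u * v ≤ M * M * (y₂ * y₃)) : 2 * min u v ≤ M * (y₂ + y₃) := by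
  have hm0 : 0 ≤ min u v := le_min hu hv
  have hsq : min u v * min u v ≤ (M * (y₂ + y₃) / 2) * (M * (y₂ + y₃) / 2) := by
    calc min u v * min u v ≤ u * v := mul_le_mul (min_le_left _ _) (min_le_right _ _) hm0 hu
      _ ≤ M * M * (y₂ * y₃) := huv
      _ ≤ (M * (y₂ + y₃) / 2) * (M * (y₂ + y₃) / 2) := by
          nlinarith [sq_nonneg (y₂ - y₃), mul_nonneg hM hM]
  have hK : 0 ≤ M * (y₂ + y₃) / 2 := by positivity
  nlinarith [abs_le_abs hsq, mul_self_nonneg (min u v - M * (y₂ + y₃) / 2),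
    mul_nonneg hm0 hK]

/-- **The diagonal block**: `x₁ y₁ + x₄ y₄ + 2 min(x₁ y₄, x₄ y₁) ≤ max(x₁, x₄)` for a product `y`. -/
theorem diag_block_le {x₁ x₄ p q : ℝ} (h1 : 0 ≤ x₁) (h4 : 0 ≤ x₄) (hp0 : 0 ≤ p) (hp1 : p ≤ 1)
    (hq0 : 0 ≤ q) (hq1 : q ≤ 1) :
    x₁ * (p * q) + x₄ * ((1 - p) * (1 - q)) + 2 * min (x₁ * ((1 - p) * (1 - q))) (x₄ * (p * q))
      ≤ max x₁ x₄ := by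
  set M := max x₁ x₄ with hMdef
  have hM1 : x₁ ≤ M := le_max_left _ _
  have hM4 : x₄ ≤ M := le_max_right _ _
  have hM0 : 0 ≤ M := h1.trans hM1
  have hp' : 0 ≤ 1 - p := sub_nonneg.2 hp1
  have hq' : 0 ≤ 1 - q := sub_nonneg.2 hq1
  have hkey : 2 * min (x₁ * ((1 - p) * (1 - q))) (x₄ * (p * q)) ≤ M * (p * (1 - q) + (1 - p) * q) := by
    refine two_mul_min_le (by positivity) (by positivity) hM0 (by positivity) (by positivity) ?_
    have e : x₁ * ((1 - p) * (1 - q)) * (x₄ * (p * q)) = x₁ * x₄ * (p * (1 - q) * ((1 - p) * q)) := by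
      ring
    rw [e]
    exact mul_le_mul_of_nonneg_right (mul_le_mul hM1 hM4 h4 hM0) (by positivity)
  have hd : x₁ * (p * q) + x₄ * ((1 - p) * (1 - q)) ≤ M * (p * q) + M * ((1 - p) * (1 - q)) :=
    add_le_add (mul_le_mul_of_nonneg_right hM1 (by positivity))
      (mul_le_mul_of_nonneg_right hM4 (by positivity))
  have e1 : M * (p * q) + M * ((1 - p) * (1 - q)) + M * (p * (1 - q) + (1 - p) * q) = M := by ring
  linarith

/-- Core of (i), oriented: `x₁ ≤ x₄`, `t ≤ x₄ + 2 (x₂ + x₃)` `⟹ 8 x₁ x₄ ≤ (2 - t)²`; the slack is the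
perfect square `¼ (3 (x₄ - x₁) + x₂ + x₃ - 1)²`, which vanishes on the corner family at `x₄ = 2/3`. -/
theorem core_i {x₁ x₂ x₃ x₄ t : ℝ} (h1 : 0 ≤ x₁) (h14 : x₁ ≤ x₄) (hs : x₁ + x₂ + x₃ + x₄ = 1)
    (ht : t ≤ x₄ + 2 * (x₂ + x₃)) : 8 * (x₁ * x₄) ≤ (2 - t) ^ 2 := by
  have hx4 : x₄ = 1 - x₁ - x₂ - x₃ := by linarith
  subst hx4
  have hT2 : (1 - x₁ - x₂ - x₃) + 2 * (x₂ + x₃) ≤ 2 := by linarith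
  have e : (2 - ((1 - x₁ - x₂ - x₃) + 2 * (x₂ + x₃))) ^ 2 - 8 * (x₁ * (1 - x₁ - x₂ - x₃))
      = (3 * ((1 - x₁ - x₂ - x₃) - x₁) + (x₂ + x₃) - 1) ^ 2 / 4 := by ring
  nlinarith [sq_nonneg (3 * ((1 - x₁ - x₂ - x₃) - x₁) + (x₂ + x₃) - 1),
    mul_nonneg (sub_nonneg.2 ht) (by linarith : (0:ℝ) ≤ 4 - t - ((1 - x₁ - x₂ - x₃) + 2 * (x₂ + x₃)))]

/-- Core of (ii), oriented: in the regime `8/9 ≤ 4 x₁ x₄` the bound `t ≤ x₄ + 2 (x₂ + x₃)` forces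
`(2t - 1)² ≤ 1 - 4 x₁ x₄` once `t ≥ ½` (the exact corner-family curve). -/
theorem core_ii {x₁ x₂ x₃ x₄ t : ℝ} (h1 : 0 ≤ x₁) (h2 : 0 ≤ x₂) (h3 : 0 ≤ x₃) (h14 : x₁ ≤ x₄)
    (hs : x₁ + x₂ + x₃ + x₄ = 1) (ht : t ≤ x₄ + 2 * (x₂ + x₃)) (ht2 : 1 / 2 ≤ t)
    (hreg : 8 / 9 ≤ 4 * (x₁ * x₄)) : (2 * t - 1) ^ 2 ≤ 1 - 4 * (x₁ * x₄) := by
  -- coordinates `d = x₄ - x₁ ≥ 0`, `s = x₂ + x₃ ∈ [0, 1]`; `4 x₁ x₄ = (1 - s)² - d²`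
  set d := x₄ - x₁ with hd
  set s := x₂ + x₃ with hsd
  have hd0 : 0 ≤ d := by rw [hd]; linarith
  have hs0 : 0 ≤ s := by rw [hsd]; linarith
  have hs1 : s ≤ 1 := by rw [hsd]; linarith
  have e4 : 4 * (x₁ * x₄) = (1 - s) ^ 2 - d ^ 2 := by
    have : x₄ = (1 - s + d) / 2 := by rw [hsd, hd]; linarith
    have h1' : x₁ = (1 - s - d) / 2 := by rw [hsd, hd]; linarith
    rw [this, h1']; ring
  have hstar : d ^ 2 + 2 * s - s ^ 2 ≤ 1 / 9 := by nlinarith [e4, hreg]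
  have hd3 : d ≤ 1 / 3 := by nlinarith [mul_nonneg hs0 (sub_nonneg.2 hs1)]
  have hs9 : s ≤ 1 / 9 := by nlinarith [sq_nonneg d]
  have h35 : 3 * d + 5 * s ≤ 1 := by nlinarith [sq_nonneg d]
  have hup : 2 * t - 1 ≤ d + 3 * s := by
    have : x₄ = (1 - s + d) / 2 := by rw [hsd, hd]; linarith
    linarith
  have hsq : (2 * t - 1) ^ 2 ≤ (d + 3 * s) ^ 2 := by
    have h0 : 0 ≤ 2 * t - 1 := by linarith
    nlinarith [mul_le_mul hup hup h0 (h0.trans hup)]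
  calc (2 * t - 1) ^ 2 ≤ (d + 3 * s) ^ 2 := hsq
    _ ≤ d ^ 2 + 2 * s - s ^ 2 := by nlinarith [mul_nonneg hs0 (by linarith : (0:ℝ) ≤ 1 - 3 * d - 5 * s)]
    _ = 1 - 4 * (x₁ * x₄) := by rw [e4]; ring

/-! ## §1b. The four-point functional

No auxiliary definition is introduced: the lemmas below are stated for ANY function `F` agreeing
with the sixteen-term expression (hypothesis `hF`), and `sum_min_curve` at the end is free of `F`. -/

section FourPoint

variable {F : ℝ → ℝ → ℝ → ℝ → ℝ → ℝ → ℝ}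
  (hF : ∀ x₁ x₂ x₃ x₄ p q : ℝ, F x₁ x₂ x₃ x₄ p q
      = x₁ * (p * q) + x₂ * (p * (1 - q)) + x₃ * ((1 - p) * q) + x₄ * ((1 - p) * (1 - q))
        + 2 * (min (x₁ * (p * (1 - q))) (x₂ * (p * q)) + min (x₁ * ((1 - p) * q)) (x₃ * (p * q))
          + min (x₁ * ((1 - p) * (1 - q))) (x₄ * (p * q))
          + min (x₂ * ((1 - p) * q)) (x₃ * (p * (1 - q)))
          + min (x₂ * ((1 - p) * (1 - q))) (x₄ * (p * (1 - q)))
          + min (x₃ * ((1 - p) * (1 - q))) (x₄ * ((1 - p) * q))))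

include hF

/-- **L1.** `F ≤ max(x₁, x₄) + 2 (x₂ + x₃)`: the diagonal block is at most `max(x₁, x₄)` and
every term touching an anti-diagonal corner is at most the mass of that corner. -/
theorem fourPoint_le_diag {x₁ x₂ x₃ x₄ p q : ℝ} (h1 : 0 ≤ x₁) (h2 : 0 ≤ x₂) (h3 : 0 ≤ x₃)
    (h4 : 0 ≤ x₄) (hp0 : 0 ≤ p) (hp1 : p ≤ 1) (hq0 : 0 ≤ q) (hq1 : q ≤ 1) :
    F x₁ x₂ x₃ x₄ p q ≤ max x₁ x₄ + 2 * (x₂ + x₃) := by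
  have hD := diag_block_le h1 h4 hp0 hp1 hq0 hq1
  have hp' : 0 ≤ 1 - p := sub_nonneg.2 hp1
  have hq' : 0 ≤ 1 - q := sub_nonneg.2 hq1
  have t12 : min (x₁ * (p * (1 - q))) (x₂ * (p * q)) ≤ x₂ * (p * q) := min_le_right _ _
  have t13 : min (x₁ * ((1 - p) * q)) (x₃ * (p * q)) ≤ x₃ * (p * q) := min_le_right _ _
  have t23 : min (x₂ * ((1 - p) * q)) (x₃ * (p * (1 - q))) ≤ x₂ * ((1 - p) * q) := min_le_left _ _
  have t24 : min (x₂ * ((1 - p) * (1 - q))) (x₄ * (p * (1 - q))) ≤ x₂ * ((1 - p) * (1 - q)) :=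
    min_le_left _ _
  have t34 : min (x₃ * ((1 - p) * (1 - q))) (x₄ * ((1 - p) * q)) ≤ x₃ * ((1 - p) * (1 - q)) :=
    min_le_left _ _
  rw [hF]
  nlinarith [mul_nonneg h2 (mul_nonneg hp0 hq0), mul_nonneg h2 (mul_nonneg hp0 hq'),
    mul_nonneg h2 (mul_nonneg hp' hq0), mul_nonneg h2 (mul_nonneg hp' hq'),
    mul_nonneg h3 (mul_nonneg hp0 hq0), mul_nonneg h3 (mul_nonneg hp0 hq'),
    mul_nonneg h3 (mul_nonneg hp' hq0), mul_nonneg h3 (mul_nonneg hp' hq')]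

/-- The relabelling `(x₁, x₂, x₃, x₄, q) ↦ (x₂, x₁, x₄, x₃, 1 - q)` (flip the second spin) leaves
the four-point functional invariant. -/
theorem fourPoint_flip (x₁ x₂ x₃ x₄ p q : ℝ) :
    F x₂ x₁ x₄ x₃ p (1 - q) = F x₁ x₂ x₃ x₄ p q := by
  simp only [hF, sub_sub_cancel]
  rw [min_comm (x₂ * (p * q)) (x₁ * (p * (1 - q))),
    min_comm (x₄ * ((1 - p) * q)) (x₃ * ((1 - p) * (1 - q)))]
  ring

/-- **(i) on the rounded pair.**  `8 |x₁ x₄ - x₂ x₃| ≤ (2 - t)²` for every `t ≤ F`. -/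
theorem fourPoint_curve_i {x₁ x₂ x₃ x₄ p q t : ℝ} (h1 : 0 ≤ x₁) (h2 : 0 ≤ x₂) (h3 : 0 ≤ x₃)
    (h4 : 0 ≤ x₄) (hs : x₁ + x₂ + x₃ + x₄ = 1) (hp0 : 0 ≤ p) (hp1 : p ≤ 1) (hq0 : 0 ≤ q)
    (hq1 : q ≤ 1) (ht : t ≤ F x₁ x₂ x₃ x₄ p q) :
    8 * |x₁ * x₄ - x₂ * x₃| ≤ (2 - t) ^ 2 := by
  have hL := fourPoint_le_diag hF h1 h2 h3 h4 hp0 hp1 hq0 hq1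
  have hL' := fourPoint_le_diag hF h2 h1 h4 h3 hp0 hp1 (sub_nonneg.2 hq1) (by linarith : 1 - q ≤ 1)
  rw [fourPoint_flip hF] at hL'
  rcases le_total (x₂ * x₃) (x₁ * x₄) with hsgn | hsgn
  · rw [abs_of_nonneg (sub_nonneg.2 hsgn)]
    rcases le_total x₁ x₄ with h14 | h41
    · rw [max_eq_right h14] at hL
      nlinarith [core_i h1 h14 hs (ht.trans hL), mul_nonneg h2 h3]
    · rw [max_eq_left h41] at hL
      nlinarith [core_i h4 h41 (by linarith) (ht.trans hL), mul_nonneg h2 h3]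
  · rw [abs_of_nonpos (sub_nonpos.2 hsgn)]
    rcases le_total x₂ x₃ with h23 | h32
    · rw [max_eq_right h23] at hL'
      nlinarith [core_i h2 h23 (by linarith) (ht.trans hL'), mul_nonneg h1 h4]
    · rw [max_eq_left h32] at hL'
      nlinarith [core_i h3 h32 (by linarith) (ht.trans hL'), mul_nonneg h1 h4]

/-- **(ii) on the rounded pair.**  In the regime `8/9 ≤ 4 |x₁ x₄ - x₂ x₃|`, every `½ ≤ t ≤ F`
has `(2t - 1)² ≤ 1 - 4 |x₁ x₄ - x₂ x₃|`, i.e. `4 |x₁ x₄ - x₂ x₃| ≤ 4 t (1 - t)`. -/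
theorem fourPoint_curve_ii {x₁ x₂ x₃ x₄ p q t : ℝ} (h1 : 0 ≤ x₁) (h2 : 0 ≤ x₂) (h3 : 0 ≤ x₃)
    (h4 : 0 ≤ x₄) (hs : x₁ + x₂ + x₃ + x₄ = 1) (hp0 : 0 ≤ p) (hp1 : p ≤ 1) (hq0 : 0 ≤ q)
    (hq1 : q ≤ 1) (ht : t ≤ F x₁ x₂ x₃ x₄ p q) (ht2 : 1 / 2 ≤ t)
    (hreg : 8 / 9 ≤ 4 * |x₁ * x₄ - x₂ * x₃|) :
    (2 * t - 1) ^ 2 ≤ 1 - 4 * |x₁ * x₄ - x₂ * x₃| := by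
  have hL := fourPoint_le_diag hF h1 h2 h3 h4 hp0 hp1 hq0 hq1
  have hL' := fourPoint_le_diag hF h2 h1 h4 h3 hp0 hp1 (sub_nonneg.2 hq1) (by linarith : 1 - q ≤ 1)
  rw [fourPoint_flip hF] at hL'
  rcases le_total (x₂ * x₃) (x₁ * x₄) with hsgn | hsgn
  · rw [abs_of_nonneg (sub_nonneg.2 hsgn)] at hreg ⊢
    have hreg' : 8 / 9 ≤ 4 * (x₁ * x₄) := by nlinarith [mul_nonneg h2 h3]
    rcases le_total x₁ x₄ with h14 | h41
    · rw [max_eq_right h14] at hL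
      nlinarith [core_ii h1 h2 h3 h14 hs (ht.trans hL) ht2 hreg', mul_nonneg h2 h3]
    · rw [max_eq_left h41] at hL
      have := core_ii h4 h2 h3 h41 (by linarith) (ht.trans hL) ht2 (by linarith)
      nlinarith [mul_nonneg h2 h3]
  · rw [abs_of_nonpos (sub_nonpos.2 hsgn)] at hreg ⊢
    have hreg' : 8 / 9 ≤ 4 * (x₂ * x₃) := by nlinarith [mul_nonneg h1 h4]
    rcases le_total x₂ x₃ with h23 | h32
    · rw [max_eq_right h23] at hL'
      have := core_ii h2 h1 h4 h23 (by linarith) (ht.trans hL') ht2 hreg'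
      nlinarith [mul_nonneg h1 h4]
    · rw [max_eq_left h32] at hL'
      have := core_ii h3 h1 h4 h32 (by linarith) (ht.trans hL') ht2 (by linarith)
      nlinarith [mul_nonneg h1 h4]

/-! ## §1c. Bookkeeping: the sixteen-term sum, and the `F`-free packaging -/

/-- The sixteen-term sum over `{±1}² × {±1}²` is the four-point functional when the model is a product. -/
theorem sum_min_eq_fourPoint (x : Bool × Bool → ℝ) (p' q' : ℝ) :
    ∑ z : Bool × Bool, ∑ w : Bool × Bool,
        min (x z * ((if w.1 then p' else 1 - p') * (if w.2 then q' else 1 - q')))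
          (x w * ((if z.1 then p' else 1 - p') * (if z.2 then q' else 1 - q')))
      = F (x (true, true)) (x (true, false)) (x (false, true)) (x (false, false)) p' q' := by
  rw [hF]
  simp only [Fintype.sum_prod_type, Fintype.sum_bool, min_self, if_true, if_false, Bool.false_eq_true]
  rw [min_comm (x (true, false) * (p' * q')) (x (true, true) * (p' * (1 - q'))),
    min_comm (x (false, true) * (p' * q')) (x (true, true) * ((1 - p') * q')),
    min_comm (x (false, true) * (p' * (1 - q'))) (x (true, false) * ((1 - p') * q')),
    min_comm (x (false, false) * (p' * q')) (x (true, true) * ((1 - p') * (1 - q'))),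
    min_comm (x (false, false) * (p' * (1 - q'))) (x (true, false) * ((1 - p') * (1 - q'))),
    min_comm (x (false, false) * ((1 - p') * q')) (x (false, true) * ((1 - p') * (1 - q')))]
  ring

/-- Packaging of (i) and (ii) for the sixteen-term sum (still relative to `hF`). -/
theorem curve_pack (x : Bool × Bool → ℝ) {p' q' t : ℝ} (hx0 : ∀ z, 0 ≤ x z)
    (hs : x (true, true) + x (true, false) + x (false, true) + x (false, false) = 1) (hp0 : 0 ≤ p')
    (hp1 : p' ≤ 1) (hq0 : 0 ≤ q') (hq1 : q' ≤ 1)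
    (ht : t ≤ ∑ z : Bool × Bool, ∑ w : Bool × Bool,
        min (x z * ((if w.1 then p' else 1 - p') * (if w.2 then q' else 1 - q')))
          (x w * ((if z.1 then p' else 1 - p') * (if z.2 then q' else 1 - q')))) :
    8 * |x (true, true) * x (false, false) - x (true, false) * x (false, true)| ≤ (2 - t) ^ 2
      ∧ (1 / 2 ≤ t → 8 / 9 ≤ 4 * |x (true, true) * x (false, false) - x (true, false) * x (false, true)| →
          (2 * t - 1) ^ 2 ≤ 1 - 4 * |x (true, true) * x (false, false) - x (true, false) * x (false, true)|) := by
  rw [sum_min_eq_fourPoint hF x p' q'] at ht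
  exact ⟨fourPoint_curve_i hF (hx0 _) (hx0 _) (hx0 _) (hx0 _) hs hp0 hp1 hq0 hq1 ht, fun ht2 hreg =>
    fourPoint_curve_ii hF (hx0 _) (hx0 _) (hx0 _) (hx0 _) hs hp0 hp1 hq0 hq1 ht ht2 hreg⟩

omit hF in
/-- **THE CURVE INEQUALITIES for the rounded pair** (target masses `x ≥ 0`, `Σ x = 1`, product model
with marginals `(p', 1 - p') ⊗ (q', 1 - q')`, `t ≤` its mean acceptance = the sixteen-term sum):
(i) `8 |x₊₊ x₋₋ - x₊₋ x₋₊| ≤ (2 - t)²`; (ii) `½ ≤ t ∧ 8/9 ≤ 4 |…| ⟹ (2 t - 1)² ≤ 1 - 4 |…|`. -/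
theorem sum_min_curve (x : Bool × Bool → ℝ) {p' q' t : ℝ} (hx0 : ∀ z, 0 ≤ x z)
    (hs : x (true, true) + x (true, false) + x (false, true) + x (false, false) = 1) (hp0 : 0 ≤ p')
    (hp1 : p' ≤ 1) (hq0 : 0 ≤ q') (hq1 : q' ≤ 1)
    (ht : t ≤ ∑ z : Bool × Bool, ∑ w : Bool × Bool,
        min (x z * ((if w.1 then p' else 1 - p') * (if w.2 then q' else 1 - q')))
          (x w * ((if z.1 then p' else 1 - p') * (if z.2 then q' else 1 - q')))) :
    8 * |x (true, true) * x (false, false) - x (true, false) * x (false, true)| ≤ (2 - t) ^ 2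
      ∧ (1 / 2 ≤ t → 8 / 9 ≤ 4 * |x (true, true) * x (false, false) - x (true, false) * x (false, true)| →
          (2 * t - 1) ^ 2 ≤ 1 - 4 * |x (true, true) * x (false, false) - x (true, false) * x (false, true)|) :=
  curve_pack (F := fun x₁ x₂ x₃ x₄ p q =>
      x₁ * (p * q) + x₂ * (p * (1 - q)) + x₃ * ((1 - p) * q) + x₄ * ((1 - p) * (1 - q))
        + 2 * (min (x₁ * (p * (1 - q))) (x₂ * (p * q)) + min (x₁ * ((1 - p) * q)) (x₃ * (p * q))
          + min (x₁ * ((1 - p) * (1 - q))) (x₄ * (p * q))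
          + min (x₂ * ((1 - p) * q)) (x₃ * (p * (1 - q)))
          + min (x₂ * ((1 - p) * (1 - q))) (x₄ * (p * (1 - q)))
          + min (x₃ * ((1 - p) * (1 - q))) (x₄ * ((1 - p) * q))))
    (fun _ _ _ _ _ _ => rfl) x hx0 hs hp0 hp1 hq0 hq1 ht

end FourPoint

end Summit.Ventures.LatticeQCDFlow.TrivializingMaps.Curve
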